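/-
# B3BlockTrace — the BLOCK-TRACE law (HUB-TRACE for every block) and three letter laws (hsemireg-monad-4 g14; evidence on stmt-HodgeConjecture-18881)

token: line stmt-HodgeConjecture-18881 Cruxes/BlochSeedDiscOne/Lines/birth.lean 814a6a70c14e831a stub_rung_pad4_seedAt (helper)

Companion of the memo `B3-BLOCKTRACE-monad4-g14.md`.  Imports Mathlib and the tree module `LinePhaseTorus` (objects of
record `MCell`, `MConfig`, `MCell.le`, `LineCell`, `lineCharge`, `betaG`, `MCell.ch`, `MConfig.wch`, `ClassScreen`, `eWord`,
the slide lemma `slide`, `wch_eWord_eq_moment_beta`).  Every declaration fully proved; no type-class declarations, no custom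
syntax, no unsafe options.  Typed here — the CHECKABLE SKELETON of the pen theorem and the letter laws:

* §1 the linear algebra of memo 2.2′–2.3′: the dimension of an annihilator `Ann(S) ⊗ W = {M : V → W, M|_S = 0}` is
  `(dim V − dim S)·dim W`; a linear map whose kernel is trapped in `Kf` has, on any subspace `U`, image of dimension
  `≥ dim U − dim Kf`; hence the survivor count `(m − σ)(m − t) − 1` of one factor;
* §2 the bound `blockTraceLB m t σ = Σ_f ((m − t)(m − σ_f) − 1)` (truncated), its diagonal case `= 4((m − s)² − 1)`
  (= g13 `hubTraceLB`), the TWIST-ray rows, the fully-fed silence and an (e3)-type partial row;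
* §3 the VISIBILITY LAW as Künneth combinatorics: a weight-2 multidegree compatible with the factor kinds
  (equal ∕ null ∕ ample) exists iff `n_null + 2·n_ample ≤ 2` (`decide` over the 3⁴ kind patterns);
* §4 the SUPPORT corollaries of the tree's slide lemma: along `MCell.le a x` between LINE cells the charged support
  shrinks, so a cell charged on ≥ 3 factors is never fed by a cell charged on ≤ 2;
* §5 the μ-LAW: on LINE configurations only 4-charged cells weigh in `wch eWord` (= μ);
* §6 HUB NEUTRALITY: the hub cell `(h,0,0)⁴` passes the class screen (A1) and has zero `eeee`-coefficient, and (A1) is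
  additive — so moving hub copies in or out of a design changes neither (A1) nor μ.

Nothing here is a theorem about sheaves on an abelian variety: the geometric content (the cocycles ξ̃_{f,M}, their
non-vanishing and σ-vanishing) is pen (memo §1).  Designs ≠ sheaves ≠ SEED; nothing is proved toward HC ∕ HC_CM ∕ HC_AV ∕
№4 ∕ 26512 ∕ 18881 ∕ H2.
-/
import Mathlib
import Summits.HodgeConjecture.HodgeConjecture.Cruxes.BlochSeedDiscOne.LinePhaseTorus

namespace Summit.HodgeConjecture.HodgeConjecture.Cruxes.BlochSeedDiscOne.BlockTrace

open Finset BigOperators Summit.Ventures.HSemireg Summit.Ventures.HSemireg.Pad4Tower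
  Summit.HodgeConjecture.HodgeConjecture.Cruxes.BlochSeedDiscOne.LinePhaseTorus

/-! ## §1 Linear algebra of memo 2.2′–2.3′ -/
section LinearAlgebra

variable {K V W X H : Type*} [Field K] [AddCommGroup V] [Module K V] [FiniteDimensional K V]
  [AddCommGroup W] [Module K W] [FiniteDimensional K W] [AddCommGroup X] [Module K X] [FiniteDimensional K X]
  [AddCommGroup H] [Module K H]

/-- `Ann(S)` with values in `W`: the linear maps `V → W` vanishing on the subspace `S` (memo: `M ∈ Ann(F + S_f)`,
`W = ℂ^m`, `V = ℂ^m`). It is the kernel of the restriction map `M ↦ M|_S`. -/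
def annMaps (S : Submodule K V) (W : Type*) [AddCommGroup W] [Module K W] : Submodule K (V →ₗ[K] W) :=
  LinearMap.ker (LinearMap.lcomp K W S.subtype)

omit [FiniteDimensional K V] [FiniteDimensional K W] in
theorem mem_annMaps {S : Submodule K V} {M : V →ₗ[K] W} : M ∈ annMaps S W ↔ M.comp S.subtype = 0 := by
  simp [annMaps, LinearMap.lcomp_apply']

omit [FiniteDimensional K V] [FiniteDimensional K W] in
/-- The restriction map `(V → W) → (S → W)` is onto (a subspace has a linear retraction). -/
theorem lcomp_subtype_surjective (S : Submodule K V) :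
    Function.Surjective (LinearMap.lcomp K W S.subtype) := by
  obtain ⟨r, hr⟩ := S.subtype.exists_leftInverse_of_injective S.ker_subtype
  intro g
  refine ⟨g.comp r, ?_⟩
  rw [LinearMap.lcomp_apply', LinearMap.comp_assoc, hr, LinearMap.comp_id]

/-- **dim Ann(S) ⊗ W = (dim V − dim S) · dim W** (memo 2.2′: `dim Ann(F+S_f) = m(m − σ_f)`, and
`dim Hom(ℂ^m∕(F+S_f), T) = (m − σ_f)·t`). -/
theorem finrank_annMaps (S : Submodule K V) :
    Module.finrank K (annMaps S W) = (Module.finrank K V - Module.finrank K S) * Module.finrank K W := by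
  have h1 := LinearMap.finrank_range_add_finrank_ker (LinearMap.lcomp K W S.subtype)
  rw [LinearMap.range_eq_top.mpr (lcomp_subtype_surjective S), finrank_top, Module.finrank_linearMap,
    Module.finrank_linearMap] at h1
  have h2 : Module.finrank K S * Module.finrank K W ≤ Module.finrank K V * Module.finrank K W :=
    Nat.mul_le_mul_right _ (Submodule.finrank_le S)
  show Module.finrank K (LinearMap.ker (LinearMap.lcomp K W S.subtype)) = _
  rw [tsub_mul]
  generalize Module.finrank K S * Module.finrank K W = a at h1 h2 ⊢
  generalize Module.finrank K V * Module.finrank K W = b at h1 h2 ⊢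
  omega

/-- Memo 2.3′: if `ker Φ ≤ Kf` then on any subspace `U` the image has dimension `≥ dim U − dim Kf`. -/
theorem finrank_sub_le_finrank_map (Φ : X →ₗ[K] H) (U Kf : Submodule K X) (hker : LinearMap.ker Φ ≤ Kf) :
    Module.finrank K U - Module.finrank K Kf ≤ Module.finrank K (U.map Φ) := by
  have h1 := LinearMap.finrank_range_add_finrank_ker (Φ.comp U.subtype)
  rw [LinearMap.range_comp, Submodule.range_subtype, LinearMap.ker_comp] at h1
  have h2 : Module.finrank K (Submodule.comap U.subtype (LinearMap.ker Φ)) ≤ Module.finrank K Kf := by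
    rw [← Submodule.finrank_map_subtype_eq U (Submodule.comap U.subtype (LinearMap.ker Φ)),
      Submodule.map_comap_subtype]
    exact Submodule.finrank_mono (le_trans inf_le_right hker)
  omega

/-- The survivor count of ONE factor (memo 2.3′): with `dim U_f ≥ m(m − σ) − 1` (traceless part of `Ann(F+S_f)`) and
`dim Kf ≤ (m − σ)·t` (the kernel trap of 2.2′), the surviving classes number `≥ (m − σ)(m − t) − 1`. -/
theorem survivors_one_factor (Φ : X →ₗ[K] H) (U Kf : Submodule K X) (hker : LinearMap.ker Φ ≤ Kf) (m σ t : ℕ)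
    (hU : m * (m - σ) - 1 ≤ Module.finrank K U) (hK : Module.finrank K Kf ≤ (m - σ) * t) :
    (m - σ) * (m - t) - 1 ≤ Module.finrank K (U.map Φ) := by
  have h := finrank_sub_le_finrank_map Φ U Kf hker
  have h3 : (m - σ) * (m - t) = (m - σ) * m - (m - σ) * t := mul_tsub _ _ _
  rw [h3]
  rw [Nat.mul_comm m (m - σ)] at hU
  generalize (m - σ) * m = p at hU ⊢
  generalize (m - σ) * t = q at hK ⊢
  omega

end LinearAlgebra

/-! ## §2 The bound β(Z) and its rows -/

/-- **β = Σ_f [(m − t)(m − σ_f) − 1]₊** (memo §1; truncated subtraction does the `[·]₊`): `m` = multiplicity of the top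
letter `Z`, `t = dim T` (fed + visible-unfed columns), `σ_f = dim(F + S_f)`. -/
def blockTraceLB (m t : ℕ) (σ : Fin 4 → ℕ) : ℕ :=
  ((m - t) * (m - σ 0) - 1) + ((m - t) * (m - σ 1) - 1) + ((m - t) * (m - σ 2) - 1) + ((m - t) * (m - σ 3) - 1)

/-- The diagonal case `t = σ_f = s` is HUB-TRACE's `4((m − s)² − 1)` (g13 `hubTraceLB`, `hubTrace_count`). -/
theorem blockTraceLB_diag (m s : ℕ) : blockTraceLB m s (fun _ => s) = 4 * ((m - s) ^ 2 - 1) := by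
  simp only [blockTraceLB, sq]
  generalize (m - s) * (m - s) = e
  omega

/-- Fully fed (or fully visible) block, `T = ℂ^m`: silent. (𝔇₁₂: `T = S = ℂ¹²`.) -/
theorem blockTraceLB_fed (m : ℕ) (σ : Fin 4 → ℕ) : blockTraceLB m m σ = 0 := by
  simp [blockTraceLB]

/-- The TWIST ray `𝔇_c`, `c = 12, …, 28`, `t = σ_f = s = 12` (memo §4 ∕ g13 §5): silent at `c = 12, 13`, then
`12, 32, 60 (D48), 96, …, 572 (T40), …, 1020`. [`decide`] -/
theorem ray_rows :
    (List.range 17).map (fun j => blockTraceLB (12 + j) 12 (fun _ => 12)) =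
      [0, 0, 12, 32, 60, 96, 140, 192, 252, 320, 396, 480, 572, 672, 780, 896, 1020] := by
  decide

/-- An (e3)-type row: free columns confined on three factors and filling codimension 1 on the fourth still leave
`3·15 + 3 = 48` classes at `m = 16, t = 12` — (e3) lowers β factor by factor, it does not switch the law off. [`decide`] -/
theorem row_e3_partial : blockTraceLB 16 12 ![12, 12, 12, 15] = 48 := by decide

/-- Codimension-one silence (𝔇₁₃-type): `t = σ_f = m − 1` gives `4·(1·1 − 1) = 0`. [`decide` at `m = 13`] -/
theorem row_D13 : blockTraceLB 13 12 (fun _ => 12) = 0 := by decide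

/-! ## §3 The VISIBILITY LAW as Künneth combinatorics

Factor kinds of the difference `D_f = Z_f − x_f` of a feeder `x ≤ Z`: `0` = equal (`Hom|_f = 𝒪`, cohomology in degrees
`{0,1,2}`), `1` = non-zero null (LINE; `Hom(Z,Z_x)|_f` past-null, degrees `{1,2}`), `2` = ample (BAND; degrees `{2}`) — the
per-factor tables `(1,2,1) ∕ (0,d,d) ∕ (0,0,χ)` of g13 `hfac`.  `H²(X, Hom(Z,Z_x)) ≠ 0` iff some multidegree `j` with
`|j| = 2` has `j_f` in the allowed degree set on every factor (all table entries in allowed degrees are positive). -/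

/-- degree `j ∈ {0,1,2}` is allowed on a factor of kind `κ ∈ {equal, null, ample}`. -/
def degAllowed (κ j : Fin 3) : Bool := (κ.val == 0) || (κ.val == 1 && j.val != 0) || (κ.val == 2 && j.val == 2)

/-- all kind ∕ degree patterns `Fin 4 → Fin 3`. -/
def patterns : List (Fin 4 → Fin 3) :=
  (List.finRange 3).flatMap fun a => (List.finRange 3).flatMap fun b =>
    (List.finRange 3).flatMap fun c => (List.finRange 3).map fun d => ![a, b, c, d]

/-- `H²`-VISIBILITY of a kind pattern: a weight-2 multidegree allowed on every factor exists. -/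
def visible (κ : Fin 4 → Fin 3) : Bool :=
  patterns.any fun j => ((j 0).val + (j 1).val + (j 2).val + (j 3).val == 2) &&
    (degAllowed (κ 0) (j 0) && degAllowed (κ 1) (j 1) && degAllowed (κ 2) (j 2) && degAllowed (κ 3) (j 3))

/-- number of factors of a given kind. -/
def nKind (κ : Fin 4 → Fin 3) (k : ℕ) : ℕ :=
  ((List.finRange 4).filter fun f => (κ f).val == k).length

/-- **VISIBILITY LAW** (memo 2.1): visible iff `n_null + 2·n_ample ≤ 2`, for all 81 kind patterns. [`decide`] -/
theorem visible_iff_all :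
    (patterns.all fun κ => visible κ == decide (nKind κ 1 + 2 * nKind κ 2 ≤ 2)) = true := by decide

/-- LINE case (no ample factor): visible iff the feeder differs from `Z` on ≤ 2 factors; for `Z` = hub: iff charged on
≤ 2 factors.  The sixteen equal∕null patterns. [`decide`] -/
theorem visible_line_iff :
    ((patterns.filter fun κ => nKind κ 2 == 0).all fun κ => visible κ == decide (nKind κ 1 ≤ 2)) = true := by decide

/-- The two famdesign facts used in §3 of the memo: a 1-charged tower letter is visible from the hub, the 4-charged
`N18` is not (g13 (N3a)); and a BAND feeder with two ample differences is already invisible. [`decide`] -/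
theorem visible_examples :
    visible ![1, 0, 0, 0] = true ∧ visible ![1, 1, 0, 0] = true ∧ visible ![1, 1, 1, 0] = false ∧
      visible ![1, 1, 1, 1] = false ∧ visible ![2, 0, 0, 0] = true ∧ visible ![2, 2, 0, 0] = false := by decide

/-! ## §4 The SUPPORT corollaries of the slide lemma (FEEDING LAW, memo 2.2) -/

/-- Along `a ≤ x` (`MCell.le a x`: `x − a` effective on every factor) between LINE cells the charge does not increase
(tree `slide`), so every factor charged in `x` is charged in `a`: `supp(x) ⊆ supp(a)`. -/
theorem charged_of_le {h : ℤ} {a x : MCell} (ha : LineCell h a) (hx : LineCell h x) (hle : MCell.le a x)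
    (f : Fin 4) (hf : 0 < lineCharge h x f) : 0 < lineCharge h a f :=
  lt_of_lt_of_le hf (slide ha hx hle f).1

/-- the charged support of a cell. -/
def support (h : ℤ) (Z : MCell) : Finset (Fin 4) := Finset.univ.filter fun f => 0 < lineCharge h Z f

theorem support_subset_of_le {h : ℤ} {a x : MCell} (ha : LineCell h a) (hx : LineCell h x) (hle : MCell.le a x) :
    support h x ⊆ support h a := by
  intro f hf
  simp only [support, Finset.mem_filter, Finset.mem_univ, true_and] at hf ⊢
  exact charged_of_le ha hx hle f hf

theorem card_support_le_of_le {h : ℤ} {a x : MCell} (ha : LineCell h a) (hx : LineCell h x) (hle : MCell.le a x) :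
    (support h x).card ≤ (support h a).card :=
  Finset.card_le_card (support_subset_of_le ha hx hle)

/-- **ORPHAN RULE**: a LINE cell charged on ≥ 3 factors (an INVISIBLE hub-feeder, §3) is never fed by a cell charged on
≤ 2 factors.  (famdesign: the towers `P46, P53` are 1-charged, so only the 4-charged `P70` could feed `N18` — and it
does not, by the phase clause of `slide_letter`; MINT alphabets: A carries 3- and 4-charged cells, memo Table B.) -/
theorem not_le_of_card_support {h : ℤ} {a x : MCell} (ha : LineCell h a) (hx : LineCell h x)
    (h3 : 3 ≤ (support h x).card) (h2 : (support h a).card ≤ 2) : ¬ MCell.le a x := fun hle => by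
  have := card_support_le_of_le ha hx hle
  omega

/-! ## §5 The μ-LAW: only 4-charged cells weigh (memo 2.3) -/

/-- a LINE cell with an uncharged factor has `Π_f β_f = 0`. -/
theorem prod_betaG_eq_zero {h : ℤ} {Z : MCell} (hZ : LineCell h Z) (h0 : ∃ f, lineCharge h Z f = 0) :
    ∏ f, betaG Z f = 0 := by
  obtain ⟨f, hf⟩ := h0
  exact Finset.prod_eq_zero (Finset.mem_univ f) (betaG_eq_zero_of_lineCharge hZ f hf)

/-- **μ-LAW**: if every cell of a LINE configuration (both sides) has an uncharged factor, then `μ = wch(eeee) = 0`. -/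
theorem wch_eWord_eq_zero_of_uncharged (h : ℤ) (C : MConfig) (mN mP : MCell → ℤ)
    (hN : ∀ Z ∈ C.lower, LineCell h Z ∧ ∃ f, lineCharge h Z f = 0)
    (hP : ∀ P ∈ C.upper, LineCell h P ∧ ∃ f, lineCharge h P f = 0) :
    C.wch mN mP eWord = 0 := by
  rw [wch_eWord_eq_moment_beta h, moment]
  have h1 : ∑ Z ∈ C.lower, mN Z • MCell.mono h Z (fun _ => 2) = 0 :=
    Finset.sum_eq_zero fun Z hZ => by rw [mono_two, prod_betaG_eq_zero (hN Z hZ).1 (hN Z hZ).2, smul_zero]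
  have h2 : ∑ P ∈ C.upper, mP P • MCell.mono h P (fun _ => 2) = 0 :=
    Finset.sum_eq_zero fun P hP' => by rw [mono_two, prod_betaG_eq_zero (hP P hP').1 (hP P hP').2, smul_zero]
  rw [h1, h2, sub_zero]

/-- **ORPHAN-FORCING, first half**: on a LINE configuration, `μ ≠ 0` forces a cell charged on all four factors. -/
theorem exists_fourCharged_of_wch_ne_zero (h : ℤ) (C : MConfig) (mN mP : MCell → ℤ)
    (hN : ∀ Z ∈ C.lower, LineCell h Z) (hP : ∀ P ∈ C.upper, LineCell h P) (hμ : C.wch mN mP eWord ≠ 0) :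
    ∃ Z ∈ C.lower ∪ C.upper, ∀ f, 0 < lineCharge h Z f := by
  by_contra hcon
  push Not at hcon
  apply hμ
  refine wch_eWord_eq_zero_of_uncharged h C mN mP (fun Z hZ => ⟨hN Z hZ, ?_⟩) (fun P hP' => ⟨hP P hP', ?_⟩)
  · obtain ⟨f, hf⟩ := hcon Z (Finset.mem_union_left _ hZ)
    exact ⟨f, le_antisymm hf (lineCharge_nonneg (hN Z hZ) f)⟩
  · obtain ⟨f, hf⟩ := hcon P (Finset.mem_union_right _ hP')
    exact ⟨f, le_antisymm hf (lineCharge_nonneg (hP P hP') f)⟩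

/-! ## §6 HUB NEUTRALITY: the hub cell is (A1)-clean and μ-neutral, and (A1) is additive (memo 2.4, §4 Q1) -/

/-- the hub cell `H⁴ = (h, 0, 0)` on every factor. -/
def hubCell (h : ℤ) : MCell := fun _ => (h, 0, 0)

/-- the hub letter vector `(1, h, h, 0, 0, h²)`: `e`- and `ē`-slots vanish. -/
theorem bphi_hub_e (h : ℤ) : bphi (h, 0, 0) 3 = 0 ∧ bphi (h, 0, 0) 4 = 0 := by
  refine ⟨?_, ?_⟩
  · rw [bphi_three]; rfl
  · rw [bphi_four]; simp; rfl

/-- e-free slots of the hub letter are powers of `h`: `bphi (h,0,0) l = h ^ ldeg l` for `l ∉ {e, ē}`. -/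
theorem bphi_hub_eFree (h : ℤ) (l : Fin 6) (hl : l ≠ 3 ∧ l ≠ 4) :
    bphi (h, 0, 0) l = (h : GaussianInt) ^ ldeg l := by
  fin_cases l <;> simp_all [bphi, phiVec, ldeg, sq]

/-- the hub's class tensor vanishes on every word containing `e` or `ē` (in particular on `eeee`: μ-neutral). -/
theorem hub_ch_eq_zero (h : ℤ) (w : CWord) (hw : ¬ EFree w) : (hubCell h).ch w = 0 := by
  rw [ch_eq_prod]
  simp only [EFree, not_forall, not_and_or, not_not] at hw
  obtain ⟨f, hf⟩ := hw
  apply Finset.prod_eq_zero (Finset.mem_univ f)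
  rcases hf with hf | hf
  · rw [hubCell, hf]; exact (bphi_hub_e h).1
  · rw [hubCell, hf]; exact (bphi_hub_e h).2

/-- on an e-free word the hub's class tensor is `h ^ wdeg w`. -/
theorem hub_ch_eFree (h : ℤ) (w : CWord) (hw : EFree w) : (hubCell h).ch w = (h : GaussianInt) ^ wdeg w := by
  rw [ch_eq_prod, Fin.prod_univ_four]
  simp only [hubCell]
  rw [bphi_hub_eFree h _ (hw 0), bphi_hub_eFree h _ (hw 1), bphi_hub_eFree h _ (hw 2), bphi_hub_eFree h _ (hw 3),
    wdeg]
  ring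

/-- **the hub cell passes the class screen (A1)** (`ClassScreen` = `InQhW` by `inQhW_iff_classScreen`). -/
theorem classScreen_hub (h : ℤ) : ClassScreen (hubCell h).ch :=
  ⟨fun w hw _ _ => hub_ch_eq_zero h w hw, fun w w' hw hw' hd => by rw [hub_ch_eFree h w hw, hub_ch_eFree h w' hw', hd]⟩

/-- (A1) is additive … -/
theorem classScreen_add {R : Type*} [AddCommGroup R] {T T' : CWord → R} (hT : ClassScreen T) (hT' : ClassScreen T') :
    ClassScreen (T + T') :=
  ⟨fun w hw h1 h2 => by rw [Pi.add_apply, hT.1 w hw h1 h2, hT'.1 w hw h1 h2, add_zero],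
    fun w w' hw hw' hd => by rw [Pi.add_apply, Pi.add_apply, hT.2 w w' hw hw' hd, hT'.2 w w' hw hw' hd]⟩

/-- … and homogeneous under integer multiplicities. -/
theorem classScreen_zsmul {R : Type*} [AddCommGroup R] {T : CWord → R} (hT : ClassScreen T) (c : ℤ) :
    ClassScreen (c • T) :=
  ⟨fun w hw h1 h2 => by rw [Pi.smul_apply, hT.1 w hw h1 h2, smul_zero],
    fun w w' hw hw' hd => by rw [Pi.smul_apply, Pi.smul_apply, hT.2 w w' hw hw' hd]⟩

/-- **(A1) is c-INDEPENDENT along a hub ray**: `T + c·ch(hub)` passes (A1) iff `T` does (memo §4: 𝔇_c). -/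
theorem classScreen_add_hub_iff (h : ℤ) (T : CWord → GaussianInt) (c : ℤ) :
    ClassScreen (T + c • (hubCell h).ch) ↔ ClassScreen T := by
  constructor
  · intro hT
    have := classScreen_add hT (classScreen_zsmul (classScreen_hub h) (-c))
    rwa [add_assoc, ← add_smul, add_neg_cancel, zero_smul, add_zero] at this
  · intro hT
    exact classScreen_add hT (classScreen_zsmul (classScreen_hub h) c)

/-- **μ is c-INDEPENDENT along a hub ray**: the `eeee`-coefficient does not see hub copies. -/
theorem eWord_add_hub (h : ℤ) (T : CWord → GaussianInt) (c : ℤ) :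
    (T + c • (hubCell h).ch) eWord = T eWord := by
  rw [Pi.add_apply, Pi.smul_apply, hub_ch_eq_zero h eWord not_eFree_eWord.1, smul_zero, add_zero]

/-- Design level: raising the multiplicity of the hub among the `P`-cells (top term C of a monad, `P = A + C`) by `δ`
shifts the weighted class tensor by `−δ·ch(hub)` — so by the two previous lemmas (A1) and μ of `𝔇_c` do not depend on `c`. -/
theorem wch_raise_hub (h : ℤ) (C : MConfig) (mN mP : MCell → ℤ) (δ : ℤ) (hmem : hubCell h ∈ C.upper) :
    C.wch mN (fun P => mP P + if P = hubCell h then δ else 0) = C.wch mN mP + (-δ) • (hubCell h).ch := by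
  have hite : ∑ P ∈ C.upper, (if P = hubCell h then δ else 0) • P.ch = δ • (hubCell h).ch := by
    rw [Finset.sum_congr rfl (fun P _ => show (if P = hubCell h then δ else 0) • P.ch =
        if P = hubCell h then δ • P.ch else 0 by split_ifs <;> simp), Finset.sum_ite_eq', if_pos hmem]
  have hsplit : ∑ P ∈ C.upper, (mP P + if P = hubCell h then δ else 0) • P.ch =
      ∑ P ∈ C.upper, mP P • P.ch + δ • (hubCell h).ch := by
    rw [← hite, ← Finset.sum_add_distrib]
    exact Finset.sum_congr rfl fun P _ => add_smul _ _ _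
  simp only [MConfig.wch]
  rw [hsplit, neg_smul]
  abel

/-- COROLLARY (memo §4 Q1): along the hub ray, (A1) holds for one multiplicity of the hub iff for all, and μ is constant. -/
theorem ray_A1_mu_invariant (h : ℤ) (C : MConfig) (mN mP : MCell → ℤ) (δ : ℤ) (hmem : hubCell h ∈ C.upper) :
    (ClassScreen (C.wch mN (fun P => mP P + if P = hubCell h then δ else 0)) ↔ ClassScreen (C.wch mN mP)) ∧
      C.wch mN (fun P => mP P + if P = hubCell h then δ else 0) eWord = C.wch mN mP eWord := by
  rw [wch_raise_hub h C mN mP δ hmem]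
  exact ⟨classScreen_add_hub_iff h _ (-δ), eWord_add_hub h _ (-δ)⟩

end Summit.HodgeConjecture.HodgeConjecture.Cruxes.BlochSeedDiscOne.BlockTrace
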